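import Literature.MathematicalPhysics.QuantumFieldTheory.Balaban1983to89.B11Eq90Transpose

/-!
# `Balaban1983to89.B11Eq88TransposeComposite` — T. Bałaban, *The variational problem and background fields in renormalization group method for lattice
# gauge theories*, Commun. Math. Phys. **102** (1985) 277–309 [Balaban1985Variational] (88)–(89) p. 291 (the rows `𝔇*(A′)H*Δ_π A′` and
# `𝔇*(A′)H*Δ_π HD(A′)`), (27) p. 282, (85) p. 291: **THE `|·|₍₋₃₎`-NORM OF A TRANSPOSED CURRENT `Mᵗ(Δπ A′)` THROUGH THE COMPOSITE KERNEL `Δπ∘M` WHEN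
# `Δπ` IS SYMMETRIC FOR THE PAIRING (27)** — `‖Mᵗ(Δπ A′)‖₍₋₃₎ ≤ ‖ρ‖‖τ‖·Θ′·‖A′‖` with `Θ′` the `(3)/(1)`-weighted column letter of the kernel of the
# COMPOSITE `Δπ∘M` (never `‖Δπ‖`): the mechanism of print's (88) bound, where `Δ_π` acts only through `H*Δ_π = (Δ_πH)ᵗ`

WHY (NE9 leaf-01 gen 97, memo `LOCATED-after-g97.md` §2 (E′)).  `B11Eq90Transpose.norm_transCur_le` bounds `‖MᵗK‖ ≤ ‖ρ‖‖τ‖Θ(M)‖K‖₍₋₃₎`; for `K = Δπ A′`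
this forces the letter `‖Δπ‖_{(1,2)→(−3)} ≳ η⁻¹`.  When `Δπ` is (27)-symmetric (`B9Eq3119DeltaPiCarrier.pairSum_currentCLM_comm` for the read `L²`
operators `π†Δ^ηπ + DR_kD*`), `Σ_{b′} τ((Δπ A′)(b′)(Mδ_bX)(b′)) = Σ_{b′} τ((Δπ Mδ_bX)(b′)A′(b′))`, so only the kernel of `Δπ∘M` and the `|·|₍₁₎`-profile of `A′`
enter — and for `M = (HD)′(A′) = H∘𝒞′∘(1 − (HD)′)` ((68)) the composite `Δπ∘H` has the lattice-free letters of `B11Eq88LaplaceH1Current{Letter,Norm,Column}`.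

WHAT THIS FILE PROVES (0 def, 0 sorry, axioms standard; [folklore] finite-dimensional algebra).  `colFun_apply_of_symm` — the one-bond functional of
`Mᵗ(Δπ A′)` rewritten through the symmetry; **`norm_transCur_le_of_symm`** — if `Σ_{b′} (w₃(b)/w₁(b′))·‖(Δπ(Mδ_bX))(b′)‖ ≤ Θ′‖X‖` for every bond `b` and
`X ∈ 𝔸`, then `‖transCur ρ τ M (Δπ A′)‖ ≤ ‖ρ‖‖τ‖·Θ′·‖A′‖` (`w₃ = (Lʲη)³`, `w₁ = Lʲη` the (115) weights; `‖A′(b′)‖ ≤ ‖A′‖/w₁(b′)`).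
HONEST SCOPE.  Mechanism only; the letter `Θ′` is DISPLAYED (supplied at the chain's letters by the composite kernel files); NOT the re-typed Prop. 4; NE9 NOT
PRINTED ∕ NOT PROVED; spine PROVED 0∕9; NOT mass gap, NOT Clay.  NEW file importing `B11Eq90Transpose` only; nothing modified.
-/

noncomputable section

open scoped BigOperators

namespace Literature.MathematicalPhysics.QuantumFieldTheory.Balaban1983to89.B11Eq88TransposeComposite

open Literature.MathematicalPhysics.QuantumFieldTheory.Balaban1983to89.B11Eq90Transpose
  (single115 colFun colFun_apply transCur transCur_apply)
open Literature.MathematicalPhysics.QuantumFieldTheory.Balaban1983to89.B11Eq90V0primeCurrent (flat115 flat115_apply)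
open B9SectCLatticeCarrier (Bond)
open B11Eq115Space

variable {𝔸 : Type*} [NormedRing 𝔸] [NormedAlgebra ℂ 𝔸]
variable {d : ℕ} {Pd : Fin d → ℕ} {L η : ℝ} {lev₀ : Bond d Pd → ℕ} {κ' : Type*} {lev₁ : κ' → ℕ}
  {Dc : (Bond d Pd → 𝔸) →ₗ[ℂ] (κ' → 𝔸)} [Fact (0 < L)] [Fact (0 < η)] [Fintype κ'] [FiniteDimensional ℂ 𝔸]

/-- **The one-bond functional of `Mᵗ(Δπ A′)` through the (27)-symmetry of `Δπ`**: `X ↦ Σ_{b′} τ((Δπ(Mδ_bX))(b′)·A′(b′))` — `Δπ` now acts on the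
column `Mδ_bX`, not on `A′`. [cite: Balaban1985Variational, (88) p.291, (27) p.282] -/
theorem colFun_apply_of_symm (τ : 𝔸 →L[ℂ] ℂ) (M : Space115 L η lev₀ lev₁ Dc →L[ℂ] Space115 L η lev₀ lev₁ Dc)
    (Δπ : Space115 L η lev₀ lev₁ Dc →L[ℂ] NegSize L η lev₀ 3 𝔸)
    (hsym : ∀ Y₁ Y₂ : Space115 L η lev₀ lev₁ Dc,
      ∑ b' : Bond d Pd, τ (NegSup.equiv (levWeight L η lev₀ 3) 𝔸 (Δπ Y₁) b' * flat115 Y₂ b') =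
        ∑ b' : Bond d Pd, τ (NegSup.equiv (levWeight L η lev₀ 3) 𝔸 (Δπ Y₂) b' * flat115 Y₁ b'))
    (A' : Space115 L η lev₀ lev₁ Dc) (b : Bond d Pd) (X : 𝔸) :
    colFun τ M (Δπ A') b X = ∑ b' : Bond d Pd, τ (NegSup.equiv (levWeight L η lev₀ 3) 𝔸 (Δπ (M (single115 b X))) b' * flat115 A' b') := by
  rw [colFun_apply]
  exact hsym A' (M (single115 b X))

/-- **`‖Mᵗ(Δπ A′)‖₍₋₃₎ ≤ ‖ρ‖‖τ‖·Θ′·‖A′‖` THROUGH THE COMPOSITE KERNEL** — for a (27)-symmetric `Δπ` and the DISPLAYED column letter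
`Σ_{b′} (w₃(b)/w₁(b′))‖(Δπ(Mδ_bX))(b′)‖ ≤ Θ′‖X‖` of `Δπ∘M`: the transposed rows of (88)/(89) without the letter `‖Δπ‖`.
[cite: Balaban1985Variational, (88)–(89) p.291, (85) p.291, (27) p.282] -/
theorem norm_transCur_le_of_symm (ρ : (𝔸 →L[ℂ] ℂ) →L[ℂ] 𝔸) (τ : 𝔸 →L[ℂ] ℂ)
    (M : Space115 L η lev₀ lev₁ Dc →L[ℂ] Space115 L η lev₀ lev₁ Dc) (Δπ : Space115 L η lev₀ lev₁ Dc →L[ℂ] NegSize L η lev₀ 3 𝔸)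
    (hsym : ∀ Y₁ Y₂ : Space115 L η lev₀ lev₁ Dc,
      ∑ b' : Bond d Pd, τ (NegSup.equiv (levWeight L η lev₀ 3) 𝔸 (Δπ Y₁) b' * flat115 Y₂ b') =
        ∑ b' : Bond d Pd, τ (NegSup.equiv (levWeight L η lev₀ 3) 𝔸 (Δπ Y₂) b' * flat115 Y₁ b'))
    {Θ : ℝ} (hΘ0 : 0 ≤ Θ)
    (hΘ : ∀ (b : Bond d Pd) (X : 𝔸), ∑ b' : Bond d Pd, levWeight L η lev₀ 3 b / levWeight L η lev₀ 1 b'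
      * ‖NegSup.equiv (levWeight L η lev₀ 3) 𝔸 (Δπ (M (single115 b X))) b'‖ ≤ Θ * ‖X‖)
    (A' : Space115 L η lev₀ lev₁ Dc) : ‖transCur ρ τ M (Δπ A')‖ ≤ ‖ρ‖ * ‖τ‖ * Θ * ‖A'‖ := by
  rw [NegSup.norm_le_iff (by positivity)]
  intro b
  have hw3 : ∀ b : Bond d Pd, 0 < levWeight L η lev₀ 3 b := levWeight_pos (Fact.out : 0 < L) (Fact.out : 0 < η) lev₀ 3
  have hw1 : ∀ b : Bond d Pd, 0 < levWeight L η lev₀ 1 b := levWeight_pos (Fact.out : 0 < L) (Fact.out : 0 < η) lev₀ 1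
  have hAb : ∀ b' : Bond d Pd, ‖flat115 A' b'‖ ≤ ‖A'‖ / levWeight L η lev₀ 1 b' := fun b' => by
    rw [le_div_iff₀ (hw1 b'), mul_comm, flat115_apply]
    exact JetSup.weight_mul_norm_apply_le A' b'
  -- the one-bond functional through the composite kernel
  have hcol : ‖colFun τ M (Δπ A') b‖ ≤ ‖τ‖ * ‖A'‖ / levWeight L η lev₀ 3 b * Θ := by
    refine ContinuousLinearMap.opNorm_le_bound _ (by have := (hw3 b).le; positivity) fun X => ?_
    rw [colFun_apply_of_symm τ M Δπ hsym A' b X]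
    calc ‖∑ b' : Bond d Pd, τ (NegSup.equiv (levWeight L η lev₀ 3) 𝔸 (Δπ (M (single115 b X))) b' * flat115 A' b')‖
        ≤ ∑ b' : Bond d Pd, ‖τ‖ * (‖NegSup.equiv (levWeight L η lev₀ 3) 𝔸 (Δπ (M (single115 b X))) b'‖ * (‖A'‖ / levWeight L η lev₀ 1 b')) :=
          (norm_sum_le _ _).trans (Finset.sum_le_sum fun b' _ =>
            (τ.le_opNorm _).trans (mul_le_mul_of_nonneg_left ((norm_mul_le _ _).trans
              (mul_le_mul_of_nonneg_left (hAb b') (norm_nonneg _))) (norm_nonneg _)))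
      _ = ‖τ‖ * ‖A'‖ / levWeight L η lev₀ 3 b * ∑ b' : Bond d Pd, levWeight L η lev₀ 3 b / levWeight L η lev₀ 1 b'
            * ‖NegSup.equiv (levWeight L η lev₀ 3) 𝔸 (Δπ (M (single115 b X))) b'‖ := by
          rw [Finset.mul_sum]
          refine Finset.sum_congr rfl fun b' _ => ?_
          have h3 : levWeight L η lev₀ 3 b ≠ 0 := (hw3 b).ne'
          have h1 : levWeight L η lev₀ 1 b' ≠ 0 := (hw1 b').ne'
          field_simp
      _ ≤ ‖τ‖ * ‖A'‖ / levWeight L η lev₀ 3 b * (Θ * ‖X‖) := by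
          have : 0 ≤ ‖τ‖ * ‖A'‖ / levWeight L η lev₀ 3 b := by have := (hw3 b).le; positivity
          exact mul_le_mul_of_nonneg_left (hΘ b X) this
      _ = ‖τ‖ * ‖A'‖ / levWeight L η lev₀ 3 b * Θ * ‖X‖ := by ring
  rw [transCur_apply]
  calc levWeight L η lev₀ 3 b * ‖ρ (colFun τ M (Δπ A') b)‖
      ≤ levWeight L η lev₀ 3 b * (‖ρ‖ * ‖colFun τ M (Δπ A') b‖) := by gcongr; exacts [(hw3 b).le, ρ.le_opNorm _]
    _ ≤ levWeight L η lev₀ 3 b * (‖ρ‖ * (‖τ‖ * ‖A'‖ / levWeight L η lev₀ 3 b * Θ)) := by gcongr; exact (hw3 b).le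
    _ = ‖ρ‖ * ‖τ‖ * Θ * ‖A'‖ := by
        have h3 : levWeight L η lev₀ 3 b ≠ 0 := (hw3 b).ne'
        field_simp

end Literature.MathematicalPhysics.QuantumFieldTheory.Balaban1983to89.B11Eq88TransposeComposite

end
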